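import Summits.HodgeConjecture.CorCM.HypLiu418.A3Liu418GSOmegaStarIrreducibleOrZero
import Summits.HodgeConjecture.CorCM.HypLiu418.A3Liu418GSOmegaStarSmooth
import Summits.HodgeConjecture.CorCM.HypLiu418.A3Liu418GSInstance
import Summits.HodgeConjecture.HodgeConjecture.Theorems.F0P3SpectralJunction
import Literature.NumberTheory.Automorphic.UnitaryCurveCohCotangentForms
import Literature.NumberTheory.Automorphic.UnitaryCurveCotangentSpectralProjection
import Literature.NumberTheory.Automorphic.UnitaryCurveCohCotangentFormsContinuous
import Literature.NumberTheory.Rogawski1990.CurveCohomologicalSpectrum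
import Literature.NumberTheory.Automorphic.UnitaryGroupCohomologicalForms
import Literature.NumberTheory.Automorphic.UnitaryGroupArchSection
import Literature.NumberTheory.Automorphic.SmoothRepresentation
import Literature.NumberTheory.Automorphic.Liu2021.Def411WeilCarriersAtLine
import Literature.NumberTheory.Automorphic.Liu2021.Def411WeilCarriersDoubling
import Literature.NumberTheory.Automorphic.UnitaryGroupLevelTransport
import Literature.NumberTheory.Automorphic.AdelicUnitaryGroupSpectrum
import Literature.NumberTheory.Automorphic.AdelicUnitaryGroupDatum
import Mathlib.RepresentationTheory.Intertwining
import HarnessLib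
import Summits.HodgeConjecture.HodgeConjecture.Theorems.HLiu418ScalarSpectralJunction
import Literature.NumberTheory.Automorphic.UnitaryCurveCotangentSpectralProjectionHerm   -- ed. 2: the (D₂) letters APPLIED at hermitian `σ_{w(ι₁)}J⋆` (R1 (α-lite), road (i′))
import Summits.HodgeConjecture.HodgeConjecture.Theorems.HLiu418CurveHodgeTypesDisjoint   -- ed. 2: `isHermitian_map_of_formCongr`

/-!
# Crux `HLiu418`, line `F0_AlbCm` ∕ sub-sub-line `F0_AlbCmS1Betti` — the EXCLUSION STUB (X) `S1ExclusionShape` FOLDED onto the engine letter E2′₂θ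
# («`ω⋆_lab` does not occur with both Hodge types»; the `n = 2` twin of ★ `Theorems/F0P3StubS5Fold.stubS5_of_spectralProjection`)

Floor-0 programme P5 (Alb-CM), seat F0P5-p03 (g0) (B2 seat 2: the `n = 2` slice of `stub_S1_betti : S1BettiShape`); crux item
stmt-HodgeConjecture-24832 (`HCCMUnconditional.HLiu418`); sub-sub-line `Cruxes/HLiu418/Lines/F0_AlbCmS1Betti.lean` (F0P5-p01 (g0), stubs
`stub_S1_realisation`, `stub_L10 : S1HolLineShape`, `stub_L01 : S1AntiholLineShape`, `stub_X : S1ExclusionShape`; waist `s1MultOneForms_of_split`).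
HC_CM is proved only modulo the 7 printed citations until rung 0 closes; this file is `sorry`-free and its named-fact inputs are HYPOTHESES.

`stub_X_of_letters` proves the TYPE `S1ExclusionShape` (restated token for token as the conclusion; the Lines decl lives in a crux workfile and is not
imported) from
* the engine letter E2′₂θ ★ `Rogawski1990.curveThetaHodgeTypeRigid` (F0P5-p02 (g0), p793937; [Liu2021, proof of Prop. D.4 (1) + Rem. D.5]: the UNSIGNED half
  of the endoscopic multiplicity formula «`m_disc(π^{(1,0)} ⊗ ω) + m_disc(π^{(0,1)} ⊗ ω) = 1`» — an irreducible smooth `σ` embedding into the finite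
  oscillator representation is not the finite component of both a `(1,0)`- and a `(0,1)`-type discrete `P`), BY NAME as the hypothesis `hE2'`;
* the analytic letter (D₂) ★ `UnitaryCurveForms.holCotFormSpectralProjection₂` ∕ `antiholCotFormSpectralProjection₂` (F0P5-p02; TP⁺: the orthogonal
  projection onto a discrete `P` of the class of a cone-(anti)holomorphic cotangent form is the class of one), BY NAME as `hTPhol` ∕ `hTPantihol`;
* (C₂) continuity on `U(J)(𝔸_{L⁺})` of the cone-holomorphic cotangent forms — ★ `UnitaryCurveForms.continuous_of_mem_holCotForms₂` (F0P5-p02 (g0), p795467), BY NAME;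
and, sorry-free in the tree ∕ this seat's files: the adjectives of `ω⋆_lab` at rank 2 (★ `subsingleton_or_isIrreducible_omegaStarGS`, ★
`isSmoothRep_omegaStarGS` — [Liu2021, Def. 4.11 ∕ Lem. D.1]: irreducible OR ZERO, smooth), anisotropy of `J⋆` from the rational frame `hg` and
definiteness off `ι₁` (`anisotropic_of_formCongr_posDef`, below) hence an automorphic measure with COMPACT quotient and discretely decomposable `L²`
(★ `AdelicUnitaryGroupSpectrum` ∕ `AdelicUnitaryGroupDatum`), and the scalar `L²` junction J1′₂ (`Theorems/HLiu418ScalarSpectralJunction`, this seat).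

PROOF.  If both a non-zero `holCotForms₂ 𝔣`-valued intertwiner `ψ` and a non-zero `conj(holCotForms₂ 𝔣)`-valued `ψ′` existed out of `ω⋆_lab`, then
`ω⋆_lab ≠ 0` is irreducible and smooth; at ONE automorphic `μ`, J1′₂ gives discrete `P`, `P′` meeting the classes of `ψ w`, `ψ′ w′` with finite component
`ω⋆_lab`; TP⁺ makes `P` of type `(1,0)` and `P′` of type `(0,1)` (the projected class is non-zero and lies in `P`); E2′₂θ at
`(σ, ιV, f) := (ω⋆_lab, (finAdelicCongr g⋆)⁻¹, id)` says no.

ED. 2 (F0P5-p03 (g2), desk ruling R1 (α-lite) ∕ road (i′) 2026-08-31T02:30:56Z; statements byte-identical, proof-only): the two applications of the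
letters (D₂)⁺ ∕ (D₂)⁻ go through ★ `UnitaryCurveForms.holCotFormSpectralProjection₂.apply_herm` ∕ `antiholCotFormSpectralProjection₂.apply_herm`
(★ `UnitaryCurveCotangentSpectralProjectionHerm`), fed the hermitian witness `σ_{w(ι₁)}J⋆` hermitian from `(ι₁ t).im = 0` (★
`CurveHodgeTypesDisjoint.isHermitian_map_of_formCongr`) — so that the letters can be sharpened in place to hermitian `σ_{w(ι)}H` (their honest domain)
with this file re-elaborating unchanged.

References: [Liu2021] arXiv:2102.11518 = Camb. J. Math. 9 (2021): Prop. D.4 (1)–(2) and proof, Rem. D.5 (p. 130–131), Def. 4.11, Lem. D.1; [Rogawski1990]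
Ann. of Math. Stud. 123, §11 (Prop. 11.1.1, 11.2.1, Thm. 11.5.1); [BorelJacquet1979] §4.6; [Borel1997] §5.14, Thm. 2.13; [DeitmarEchterhoff2014] Thm. 9.2.2.
-/

set_option autoImplicit false
-- the mandated namespace repeats `HodgeConjecture.HodgeConjecture`, as in every `Theorems/*.lean` of this sub-problem
set_option linter.dupNamespace false

noncomputable section

namespace Summit.HodgeConjecture.HodgeConjecture.Cruxes.HLiu418.S1BettiSliceExclusion

open scoped TensorProduct Matrix NumberField Kronecker ComplexOrder InnerProductSpace ENNReal
open MeasureTheory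
open NumberField NumberField.InfinitePlace IsDedekindDomain
open Summit.HodgeConjecture.CorCM.Model Summit.HodgeConjecture.CorCM.Model.HComp Summit.HodgeConjecture.CorCM.HComp
open Literature.AlgebraicGeometry.Motives (CMType AbelianVariety)
open Literature.AlgebraicGeometry.ShimuraVarieties Literature.AlgebraicGeometry.ShimuraVarieties.UnitaryCanonicalModel
open Literature.NumberTheory.Automorphic Literature.NumberTheory.Automorphic.UnitaryGroup Literature.NumberTheory.Automorphic.UnitaryCurveForms
open Literature.NumberTheory.Automorphic.UnitaryGroup.CotangentForms (toQuotFun toQuotFun_mk)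
open Literature.NumberTheory.Automorphic.IdeleClassGroup Literature.NumberTheory.Automorphic.Liu2021 Literature.NumberTheory.Automorphic.Liu2021.AppendixC
open Literature.NumberTheory.GaloisRepresentations Literature.RepresentationTheory.Liu2021 Literature.RepresentationTheory.HarrisKudlaSweet1996
open Literature.AlgebraicGeometry.Liu2021 (IsAdmissibleElement)
open Literature.NumberTheory.Weil1964 Literature.NumberTheory.GelbartRogawski1991 Literature.NumberTheory.GelbartRogawski1991.UnitaryDualPair Literature.NumberTheory.GelbartRogawski1991.UnitaryDualPair.WeilCoinv
open Literature.NumberTheory.GelbartRogawski1991.UnitaryDualPair.LocalSplitting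
open Literature.NumberTheory.Automorphic.Liu2021.Def411WeilCarriersDoubling
open Literature.NumberTheory.Automorphic.Liu2021.Def411WeilCarriers (TW JW JW_eq isSymm_TW isUnit_det_TW Rep Eps epsOf Chi rhoVAtLine rhoAtLine omegaAtLine)
open Summit.HodgeConjecture.CorCM (CMField)
open Summit.HodgeConjecture.CorCM.Lines.A3Liu418
open Summit.HodgeConjecture.HodgeConjecture.Cruxes.H413.F0P3HilbertProjection
open Summit.HodgeConjecture.HodgeConjecture.Cruxes.H413.SpectrumJunction
open Summit.HodgeConjecture.HodgeConjecture.Cruxes.HLiu418.ScalarSpectralJunction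

/-! ## §1 Left invariance and continuity of the two Hodge types of curve cotangent forms -/

section Helpers

variable {F₀ E : Type} [Field F₀] [NumberField F₀] [Field E] [NumberField E] [Algebra F₀ E]
  {c : E ≃ₐ[F₀] E} {J : Matrix (Fin 2) (Fin 2) E}
  {hc : c ≠ 1} {hfix : ∀ w : InfinitePlace E, c • w = w} {w₁ : {w : InfinitePlace E // IsComplex w}} {𝔣 : ConeFrame E J w₁}

/-- Holomorphic curve cotangent forms are left-`U(J)(F)`-invariant under the quotient subgroup of the unitary datum (clause (L) of `holCotForms₂`;
`U(J)` has trivial split component, ★ `quotientSubgroup_adelicGroupData`). [cite: BorelJacquet1979, §4.2] -/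
theorem leftInvariant_of_mem_holCotForms₂ {f : (adelicGroupData F₀ E c 2 J).Adelic → ℂ} (hf : f ∈ holCotForms₂ F₀ E c J hc hfix w₁ 𝔣) :
    ∀ γ ∈ (adelicGroupData F₀ E c 2 J).quotientSubgroup, ∀ x, f (γ * x) = f x := by
  intro γ hγ x
  rw [quotientSubgroup_adelicGroupData] at hγ
  obtain ⟨γ₀, rfl⟩ := hγ
  exact ((mem_holCotForms₂_iff F₀ E c J hc hfix w₁ 𝔣 f).1 hf).1 γ₀ x

/-- Antiholomorphic curve cotangent forms are left-`U(J)(F)`-invariant. [cite: BorelJacquet1979, §4.2] -/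
theorem leftInvariant_of_mem_map_conjFun₂ {f : (adelicGroupData F₀ E c 2 J).Adelic → ℂ}
    (hf : f ∈ (holCotForms₂ F₀ E c J hc hfix w₁ 𝔣).map (conjFun₂ F₀ E c J)) :
    ∀ γ ∈ (adelicGroupData F₀ E c 2 J).quotientSubgroup, ∀ x, f (γ * x) = f x := by
  intro γ hγ x
  obtain ⟨f₀, hf₀, rfl⟩ := Submodule.mem_map.1 hf
  show star (f₀ (γ * x)) = star (f₀ x)
  rw [leftInvariant_of_mem_holCotForms₂ hf₀ γ hγ x]

end Helpers

/-! ## §2 `J⋆` is anisotropic: a rational frame `ᵗ(c g⋆) (t • J⋆) g⋆ = diag dJ` with `diag dJ` positive definite at ONE complex place -/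

section Anisotropy

variable (L : Type) [Field L] [NumberField L] [IsCMField L]

omit [NumberField L] [IsCMField L] in
/-- `⟪v, w⟫_{σ(T)ᵀ H T} = ⟪T v, T w⟫_H`: the form of a congruent Gram matrix. [folklore] -/
theorem hermForm_formCongr (σ : L →+* L) (T : GL (Fin 2) L) (H : Matrix (Fin 2) (Fin 2) L) (v w : Fin 2 → L) :
    Literature.AlgebraicGeometry.ShimuraVarieties.hermForm σ (formCongr σ T H) v w = Literature.AlgebraicGeometry.ShimuraVarieties.hermForm σ H ((T : Matrix (Fin 2) (Fin 2) L) *ᵥ v) ((T : Matrix (Fin 2) (Fin 2) L) *ᵥ w) := by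
  have h1 : (⇑σ ∘ ((T : Matrix (Fin 2) (Fin 2) L) *ᵥ v)) = ((T : Matrix (Fin 2) (Fin 2) L).map σ) *ᵥ (⇑σ ∘ v) :=
    funext fun i => RingHom.map_mulVec σ _ v i
  show (⇑σ ∘ v) ⬝ᵥ ((((T : Matrix (Fin 2) (Fin 2) L).map σ)ᵀ * H * (T : Matrix (Fin 2) (Fin 2) L)) *ᵥ w) =
    (⇑σ ∘ ((T : Matrix (Fin 2) (Fin 2) L) *ᵥ v)) ⬝ᵥ (H *ᵥ ((T : Matrix (Fin 2) (Fin 2) L) *ᵥ w))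
  rw [h1, ← Matrix.mulVec_mulVec, ← Matrix.mulVec_mulVec, Matrix.dotProduct_mulVec (⇑σ ∘ v), Matrix.vecMul_transpose]

/-- The coercion of `IsCMField.complexConj` to a ring homomorphism IS `cmConjRingHom` (pointwise `rfl`). [folklore] -/
theorem coe_complexConj_eq_cmConjRingHom :
    ((IsCMField.complexConj L : L ≃ₐ[↥(maximalRealSubfield L)] L) : L →+* L) = cmConjRingHom L :=
  RingHom.ext fun _ => rfl

/-- **`J⋆` IS ANISOTROPIC.**  If `ᵗ(c g⋆) (t • J⋆) g⋆ = diag dJ` (`g⋆ ∈ GL₂(L)`) and `diag dJ` is positive definite at some complex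
embedding `τ`, then `⟪x, x⟫_{J⋆} = 0 ⇒ x = 0` on `L²` (no hypothesis on `t` is needed): `t ⟪x, x⟫_{J⋆} = ⟪g⋆⁻¹x, g⋆⁻¹x⟫_{diag dJ}` and `diag dJ` is anisotropic (★
`anisotropic_of_posDef_map`).  This is the hypothesis of ★ `exists_isAutomorphicMeasure_isDiscretelyDecomposable_adelicGroupData` and of
★ `compactSpace_cmDatum_automorphicQuotient`. [folklore] -/
theorem anisotropic_of_formCongr_posDef (Jstar : Matrix (Fin 2) (Fin 2) L) (t : L) (gstar : GL (Fin 2) L)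
    (dJ : Fin 2 → L)
    (hg : formCongr ((IsCMField.complexConj L : L ≃ₐ[↥(maximalRealSubfield L)] L) : L →+* L) gstar (t • Jstar) = Matrix.diagonal dJ)
    (τ : L →+* ℂ) (hτ : ((Matrix.diagonal dJ).map τ).PosDef) :
    ∀ x : Fin 2 → L, Literature.AlgebraicGeometry.ShimuraVarieties.hermForm (cmConjRingHom L) Jstar x x = 0 → x = 0 := by
  intro x hx
  have hD := UnitaryGroup.anisotropic_of_posDef_map L (Matrix.diagonal dJ) τ hτ
  rw [coe_complexConj_eq_cmConjRingHom] at hg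
  have hM : t • Jstar = formCongr (cmConjRingHom L) gstar⁻¹ (Matrix.diagonal dJ) := by
    rw [← hg, formCongr_inv_formCongr]
  have h1 : Literature.AlgebraicGeometry.ShimuraVarieties.hermForm (cmConjRingHom L) (t • Jstar) x x = t * Literature.AlgebraicGeometry.ShimuraVarieties.hermForm (cmConjRingHom L) Jstar x x := by
    show (⇑(cmConjRingHom L) ∘ x) ⬝ᵥ ((t • Jstar) *ᵥ x) = t * ((⇑(cmConjRingHom L) ∘ x) ⬝ᵥ (Jstar *ᵥ x))
    rw [Matrix.smul_mulVec, dotProduct_smul, smul_eq_mul]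
  have h2 : Literature.AlgebraicGeometry.ShimuraVarieties.hermForm (cmConjRingHom L) (Matrix.diagonal dJ) (((gstar⁻¹ : GL (Fin 2) L) : Matrix (Fin 2) (Fin 2) L) *ᵥ x)
      (((gstar⁻¹ : GL (Fin 2) L) : Matrix (Fin 2) (Fin 2) L) *ᵥ x) = 0 := by
    rw [← hermForm_formCongr, ← hM, h1, hx, mul_zero]
  have h3 := hD _ h2
  have hx' : x = ((gstar : GL (Fin 2) L) : Matrix (Fin 2) (Fin 2) L) *ᵥ ((((gstar⁻¹ : GL (Fin 2) L) : Matrix (Fin 2) (Fin 2) L)) *ᵥ x) := by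
    rw [Matrix.mulVec_mulVec, ← Units.val_mul, mul_inv_cancel, Units.val_one, Matrix.one_mulVec]
  rw [hx', h3, Matrix.mulVec_zero]

end Anisotropy

/-! ## §3 The fold: (X) `S1ExclusionShape` from E2′₂θ, TP⁺ and continuity -/

set_option synthInstance.maxHeartbeats 400000 in
set_option maxHeartbeats 4000000 in
/-- **THE (X) FOLD — `S1ExclusionShape` from the engine letter E2′₂θ (`hE2' : Rogawski1990.curveThetaHodgeTypeRigid`, ★ p793937, BY NAME), the representable
analytic letter TP⁺ (`hTPhol` ∕ `hTPantihol : UnitaryCurveForms.(anti)holCotFormSpectralProjection₂`, ★, BY NAME) and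
the ★ continuity of holomorphic curve cotangent forms.**  Its ONLY hypotheses are the three ★ letters.  Conclusion = the TYPE of the sub-sub-line's `stub_X : S1ExclusionShape`
(`Cruxes/HLiu418/Lines/F0_AlbCmS1Betti`, binder prefix of `S1MultOneFormsShape` with `h4`) TOKEN FOR TOKEN.  Proof in the module docstring.
HC_CM is proved only modulo the 7 printed citations until rung 0 closes. [cite: Liu2021, Prop. D.4 (1)–(2) and proof; Rem. D.5 (p. 130–131)]
[cite: Rogawski1990, §11.1 Prop. 11.1.1; Prop. 11.2.1 (b); Thm. 11.5.1 (b)] [cite: BorelJacquet1979, §4.6] -/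
theorem stub_X_of_letters (hE2' : Literature.NumberTheory.Rogawski1990.curveThetaHodgeTypeRigid)
    (hTPhol : Literature.NumberTheory.Automorphic.UnitaryCurveForms.holCotFormSpectralProjection₂)
    (hTPantihol : Literature.NumberTheory.Automorphic.UnitaryCurveForms.antiholCotFormSpectralProjection₂)
    :
      ∀ (F : CMField) [IsGalois ℚ F] (ι₁ : F →+* ℂ)
        (μ : Literature.NumberTheory.Automorphic.IdeleClassGroup (F : Type) →ₜ* Circle)
        (hμ : IdeleClassGroup.IsConjugateSymplectic (F : Type) μ)
        (_hw : IdeleClassGroup.HasWeight (F : Type) μ 1)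
        (Jstar : Matrix (Fin 2) (Fin 2) (F : Type)) (t : (F : Type)) (ht : t ≠ 0) (_hτt : 0 < (ι₁ t).re) (_hτt' : (ι₁ t).im = 0)
        (gstar : GL (Fin 2) (F : Type))
        (dJ : Fin 2 → (F : Type)) (hdJ : ∀ i, IsCMField.complexConj (F : Type) (dJ i) = dJ i) (hdJ0 : ∀ i, dJ i ≠ 0)
        (hg : formCongr ((IsCMField.complexConj (F : Type) : (F : Type) ≃ₐ[↥(maximalRealSubfield (F : Type))] (F : Type)) :
            (F : Type) →+* (F : Type)) gstar (t • Jstar) = Matrix.diagonal dJ)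
        (_hsig : (∃ Tstar : GL (Fin 2) ℂ,
            formCongr (starRingEnd ℂ) Tstar ((Matrix.diagonal dJ).map ι₁) = Matrix.diagonal ![(1 : ℂ), -1]) ∧
          ∀ τ' : (F : Type) →+* ℂ, InfinitePlace.mk τ' ≠ InfinitePlace.mk ι₁ → ((Matrix.diagonal dJ).map τ').PosDef)
        (h4 : 4 ≤ Module.finrank ℚ (F : Type))
        (r : Rep ↥(maximalRealSubfield (F : Type)) (imagUnitSq F))
        (ε : Eps ↥(maximalRealSubfield (F : Type)) (imagUnitSq F))
        (_hadm : ∃ e : (F : Type), IsAdmissibleElement (F : Type) hμ.cmType.1 e ∧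
          epsOf ↥(maximalRealSubfield (F : Type)) (imagUnitSq F) (F : Type) (2 * imagUnit (F : Type))⁻¹ (-e) = ε)
        (χ : Chi ↥(maximalRealSubfield (F : Type)) (F : Type) (IsCMField.complexConj (F : Type)))
        (𝔣 : ConeFrame (F : Type) Jstar (cmPlace (F : Type) ι₁)),
        (∀ ψ : Representation.IntertwiningMap
            ((rhoVAtLine ↥(maximalRealSubfield (F : Type)) (F : Type) (IsCMField.complexConj (F : Type)) 2
              (finProdFinEquiv : Fin 2 × Fin 1 ≃ Fin (2 * 1)) (Matrix.diagonal dJ)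
              (complexConj_imagUnit F) (imagUnit_ne_zero F) (imagUnit_mul_self F) (realDiagonal_isSymm F dJ hdJ)
              (isUnit_det_realDiagonal F dJ hdJ hdJ0) (realDiagonal_map F dJ hdJ).symm
              (hsChiGS F finProdFinEquiv dJ hdJ hdJ0
                (toHeckeCharacter (F : Type) (galConj (IsCMField.complexConj (F : Type)) μ))
                (isUnitary_toHeckeCharacter (F : Type) (galConj (IsCMField.complexConj (F : Type)) μ))
                ((isOscillatorChar_toHeckeCharacter_iff (galConj (IsCMField.complexConj (F : Type)) μ)).mpr hμ.galConj))
              (r.toFun ε) χ).comp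
              (finAdelicCongr ↥(maximalRealSubfield (F : Type)) (F : Type) (IsCMField.complexConj (F : Type)) gstar ht hg).symm.toMonoidHom)
            (rightRep₂ ↥(maximalRealSubfield (F : Type)) (F : Type) (IsCMField.complexConj (F : Type)) Jstar),
          (∀ w, ψ w ∈ holCotForms₂ ↥(maximalRealSubfield (F : Type)) (F : Type) (IsCMField.complexConj (F : Type)) Jstar
              (IsCMField.complexConj_ne_one (F : Type)) (UnitaryGroup.complexConj_smul_infinitePlace (F : Type))
              (cmPlace (F : Type) ι₁) 𝔣) → ψ = 0) ∨
        (∀ ψ : Representation.IntertwiningMap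
            ((rhoVAtLine ↥(maximalRealSubfield (F : Type)) (F : Type) (IsCMField.complexConj (F : Type)) 2
              (finProdFinEquiv : Fin 2 × Fin 1 ≃ Fin (2 * 1)) (Matrix.diagonal dJ)
              (complexConj_imagUnit F) (imagUnit_ne_zero F) (imagUnit_mul_self F) (realDiagonal_isSymm F dJ hdJ)
              (isUnit_det_realDiagonal F dJ hdJ hdJ0) (realDiagonal_map F dJ hdJ).symm
              (hsChiGS F finProdFinEquiv dJ hdJ hdJ0
                (toHeckeCharacter (F : Type) (galConj (IsCMField.complexConj (F : Type)) μ))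
                (isUnitary_toHeckeCharacter (F : Type) (galConj (IsCMField.complexConj (F : Type)) μ))
                ((isOscillatorChar_toHeckeCharacter_iff (galConj (IsCMField.complexConj (F : Type)) μ)).mpr hμ.galConj))
              (r.toFun ε) χ).comp
              (finAdelicCongr ↥(maximalRealSubfield (F : Type)) (F : Type) (IsCMField.complexConj (F : Type)) gstar ht hg).symm.toMonoidHom)
            (rightRep₂ ↥(maximalRealSubfield (F : Type)) (F : Type) (IsCMField.complexConj (F : Type)) Jstar),
          (∀ w, ψ w ∈ (holCotForms₂ ↥(maximalRealSubfield (F : Type)) (F : Type) (IsCMField.complexConj (F : Type)) Jstar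
              (IsCMField.complexConj_ne_one (F : Type)) (UnitaryGroup.complexConj_smul_infinitePlace (F : Type))
              (cmPlace (F : Type) ι₁) 𝔣).map (conjFun₂ ↥(maximalRealSubfield (F : Type)) (F : Type) (IsCMField.complexConj (F : Type)) Jstar)) → ψ = 0) := by
  intro F _ ι₁ μ hμ hw Jstar t ht hτt hτt' gstar dJ hdJ hdJ0 hg hsig h4 r ε hadm χ 𝔣
  by_contra hcon
  rw [not_or] at hcon
  obtain ⟨hA, hB⟩ := hcon
  push Not at hA hB
  obtain ⟨ψ, hψv, hψ0⟩ := hA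
  obtain ⟨ψ', hψ'v, hψ'0⟩ := hB
  -- `J⋆` anisotropic ⇒ an automorphic measure with COMPACT quotient and discretely decomposable `L²`
  obtain ⟨τ, hτ⟩ := UnitaryGroup.exists_infinitePlace_ne (F : Type) h4 ι₁
  have hanis := anisotropic_of_formCongr_posDef (F : Type) Jstar t gstar dJ hg τ (hsig.2 τ hτ)
  obtain ⟨μA, hμA, hdisc⟩ :=
    UnitaryGroup.exists_isAutomorphicMeasure_isDiscretelyDecomposable_adelicGroupData (F : Type) 2 Jstar hanis
  haveI := hμA
  haveI : CompactSpace (adelicGroupData ↥(maximalRealSubfield (F : Type)) (F : Type) (IsCMField.complexConj (F : Type)) 2 Jstar).automorphicQuotient :=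
    UnitaryGroup.compactSpace_cmDatum_automorphicQuotient (F : Type) 2 Jstar hanis
  -- `ω⋆_lab ≠ 0` (as `ψ ≠ 0`), hence irreducible (★ irreducible-or-zero), and smooth (★)
  obtain ⟨w₁, hw₁⟩ : ∃ w, ψ w ≠ 0 := by
    by_contra h
    push Not at h
    exact hψ0 (Representation.IntertwiningMap.ext (LinearMap.ext h))
  haveI hnt : Nontrivial _ := ⟨⟨w₁, 0, fun h => hw₁ (by rw [h, map_zero])⟩⟩
  have hirr := (subsingleton_or_isIrreducible_omegaStarGS F dJ hdJ hdJ0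
    (toHeckeCharacter (F : Type) (galConj (IsCMField.complexConj (F : Type)) μ))
    (isUnitary_toHeckeCharacter (F : Type) (galConj (IsCMField.complexConj (F : Type)) μ))
    ((isOscillatorChar_toHeckeCharacter_iff (galConj (IsCMField.complexConj (F : Type)) μ)).mpr hμ.galConj)
    (r.toFun ε) χ ht gstar hg).resolve_left (not_subsingleton _)
  have hsmR := isSmoothRep_omegaStarGS F dJ hdJ hdJ0
    (toHeckeCharacter (F : Type) (galConj (IsCMField.complexConj (F : Type)) μ))
    (isUnitary_toHeckeCharacter (F : Type) (galConj (IsCMField.complexConj (F : Type)) μ))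
    ((isOscillatorChar_toHeckeCharacter_iff (galConj (IsCMField.complexConj (F : Type)) μ)).mpr hμ.galConj)
    (r.toFun ε) χ ht gstar hg
  have hsm : Representation.IsSmooth
      ((rhoVAtLine ↥(maximalRealSubfield (F : Type)) (F : Type) (IsCMField.complexConj (F : Type)) 2
          (finProdFinEquiv : Fin 2 × Fin 1 ≃ Fin (2 * 1)) (Matrix.diagonal dJ)
          (complexConj_imagUnit F) (imagUnit_ne_zero F) (imagUnit_mul_self F) (realDiagonal_isSymm F dJ hdJ)
          (isUnit_det_realDiagonal F dJ hdJ hdJ0) (realDiagonal_map F dJ hdJ).symm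
          (hsChiGS F finProdFinEquiv dJ hdJ hdJ0
            (toHeckeCharacter (F : Type) (galConj (IsCMField.complexConj (F : Type)) μ))
            (isUnitary_toHeckeCharacter (F : Type) (galConj (IsCMField.complexConj (F : Type)) μ))
            ((isOscillatorChar_toHeckeCharacter_iff (galConj (IsCMField.complexConj (F : Type)) μ)).mpr hμ.galConj))
          (r.toFun ε) χ).comp
          (finAdelicCongr ↥(maximalRealSubfield (F : Type)) (F : Type) (IsCMField.complexConj (F : Type)) gstar ht hg).symm.toMonoidHom) :=
    fun v => by
      obtain ⟨S, hS, hfixv⟩ := hsmR v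
      exact Representation.isSmoothVector_of_le _ hS fun k hk => hfixv k hk
  -- continuity hypotheses at this frame
  have hcontA : ∀ f ∈ holCotForms₂ ↥(maximalRealSubfield (F : Type)) (F : Type) (IsCMField.complexConj (F : Type)) Jstar
      (IsCMField.complexConj_ne_one (F : Type)) (UnitaryGroup.complexConj_smul_infinitePlace (F : Type)) (cmPlace (F : Type) ι₁) 𝔣,
      Continuous f := fun f hf => continuous_of_mem_holCotForms₂ _ _ _ _ _ _ _ 𝔣 hf
  -- the junction J1′₂, twice (same `μA`)
  obtain ⟨P, w, h, hu, hfin⟩ := exists_discreteAutomorphicRep_not_orthogonal_hasFinComponent (μ := μA) hdisc _ hirr ψ.toLinearMap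
    (fun g w x => by
      show ψ (_) x = ψ w _
      rw [Representation.IntertwiningMap.isIntertwining]
      rfl)
    (fun w => leftInvariant_of_mem_holCotForms₂ (hψv w)) (fun w => hcontA (ψ w) (hψv w))
    (fun h0 => hψ0 (Representation.IntertwiningMap.ext h0))
  obtain ⟨P', w', h', hu', hfin'⟩ := exists_discreteAutomorphicRep_not_orthogonal_hasFinComponent (μ := μA) hdisc _ hirr ψ'.toLinearMap
    (fun g w x => by
      show ψ' (_) x = ψ' w _
      rw [Representation.IntertwiningMap.isIntertwining]
      rfl)
    (fun w => leftInvariant_of_mem_map_conjFun₂ (hψ'v w)) (fun w => continuous_of_mem_map_conjFun₂ _ _ _ _ _ _ _ 𝔣 (hψ'v w))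
    (fun h0 => hψ'0 (Representation.IntertwiningMap.ext h0))
  -- TP⁺: `P` is of type (1,0), `P′` of type (0,1)
  -- ed. 2: the letters applied AT HERMITIAN `σ_{w(ι₁)}J⋆` (★ `….apply_herm`), witness from `(ι₁ t).im = 0`
  have hJherm : (Jstar.map (cmPlace (F : Type) ι₁).1.embedding).IsHermitian :=
    CurveHodgeTypesDisjoint.isHermitian_map_of_formCongr (F : Type) ι₁ Jstar t ht hτt' gstar dJ hdJ hg _
  obtain ⟨f₁, hf₁, hf₁L, heq₁⟩ :=
    hTPhol.apply_herm (F : Type) ι₁ Jstar dJ hdJ hdJ0 t ht gstar hg hJherm hsig.1 hsig.2 h4 𝔣 μA P (ψ w) (hψv w) h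
  obtain ⟨f₂, hf₂, hf₂L, heq₂⟩ :=
    hTPantihol.apply_herm (F : Type) ι₁ Jstar dJ hdJ hdJ0 t ht gstar hg hJherm hsig.1 hsig.2 h4 𝔣 μA P' (ψ' w') (hψ'v w') h'
  have hne₁ : MemLp.toLp (toQuotFun _ f₁) hf₁L ≠ 0 := by
    rw [← heq₁, Submodule.starProjection_apply]
    exact Subtype.coe_ne_coe.mpr (orthogonalProjectionOnto_ne_zero P.space hu)
  have hne₂ : MemLp.toLp (toQuotFun _ f₂) hf₂L ≠ 0 := by
    rw [← heq₂, Submodule.starProjection_apply]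
    exact Subtype.coe_ne_coe.mpr (orthogonalProjectionOnto_ne_zero P'.space hu')
  have hP : ∃ f ∈ holCotForms₂ ↥(maximalRealSubfield (F : Type)) (F : Type) (IsCMField.complexConj (F : Type)) Jstar
      (IsCMField.complexConj_ne_one (F : Type)) (UnitaryGroup.complexConj_smul_infinitePlace (F : Type)) (cmPlace (F : Type) ι₁) 𝔣,
      f ≠ 0 ∧ ∃ hh : MemLp (toQuotFun _ f) 2 μA, MemLp.toLp (toQuotFun _ f) hh ∈ P.space.toSubmodule := by
    refine ⟨f₁, hf₁, ?_, hf₁L, ?_⟩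
    · rintro rfl
      exact hne₁ (MemLp.toLp_zero hf₁L)
    · rw [← heq₁]
      exact Submodule.starProjection_apply_mem _ _
  have hP' : ∃ f ∈ (holCotForms₂ ↥(maximalRealSubfield (F : Type)) (F : Type) (IsCMField.complexConj (F : Type)) Jstar
      (IsCMField.complexConj_ne_one (F : Type)) (UnitaryGroup.complexConj_smul_infinitePlace (F : Type)) (cmPlace (F : Type) ι₁) 𝔣).map
      (conjFun₂ ↥(maximalRealSubfield (F : Type)) (F : Type) (IsCMField.complexConj (F : Type)) Jstar),
      f ≠ 0 ∧ ∃ hh : MemLp (toQuotFun _ f) 2 μA, MemLp.toLp (toQuotFun _ f) hh ∈ P'.space.toSubmodule := by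
    refine ⟨f₂, hf₂, ?_, hf₂L, ?_⟩
    · rintro rfl
      exact hne₂ (MemLp.toLp_zero hf₂L)
    · rw [← heq₂]
      exact Submodule.starProjection_apply_mem _ _
  -- the engine letter E2′₂θ at `(σ, ιV, f) := (ω⋆_lab, (finAdelicCongr g⋆)⁻¹, id)`: impossible
  exact hE2' (F : Type) ι₁ Jstar dJ hdJ hdJ0 t ht gstar hg hsig.1 hsig.2 h4 𝔣 μA finProdFinEquiv
    (toHeckeCharacter (F : Type) (galConj (IsCMField.complexConj (F : Type)) μ))
    (isUnitary_toHeckeCharacter (F : Type) (galConj (IsCMField.complexConj (F : Type)) μ))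
    ((isOscillatorChar_toHeckeCharacter_iff (galConj (IsCMField.complexConj (F : Type)) μ)).mpr hμ.galConj)
    (r.toFun ε) χ _ _ hirr hsm ⟨LinearMap.id, fun _ => rfl⟩ (fun _ _ hxy => hxy) P P' hP hP' hfin hfin'

end Summit.HodgeConjecture.HodgeConjecture.Cruxes.HLiu418.S1BettiSliceExclusion

end
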